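import Summits.BirchSwinnertonDyer.BirchSwinnertonDyer.Theorems.TameQuarticSolventLowerBSD3OverSolventQuarticHabitat
import Summits.BirchSwinnertonDyer.BirchSwinnertonDyer.Theorems.TameQuarticSolventLowerBSD3OverSolventQuarticRamification
import HarnessLib

/-!
# Route `TameQuarticSolvent`, crux `SolventPairLowerBound` (stmt-BirchSwinnertonDyer-21391), split child
# `LowerBSD3OverSolventQuartic` (stmt-BirchSwinnertonDyer-23963, K1⁻): THE LOCAL CRITERION AT `p = 3` ON THE
# (t′) CELL — `E_L` good at `v ∣ 3` ⟺ `E_L` semistable at `v` ⟺ `4 ∣ e(v|3)`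

HONEST FRAMING. Theorems only; the two-line assembly of the two width-seat halves landed for the split child
`LowerBSD3OverSolventQuartic` of the deciding crux of route `TameQuarticSolvent`
(`--supports stmt-BirchSwinnertonDyer-23963`): the forward half `four_dvd_ramificationIdx_of_hasGoodReductionAt`
(`…LowerBSD3OverSolventQuarticRamification.lean`, seat tqs-p1-w2 g3) and the converse half
`hasGoodReductionAt_baseChange_of_four_dvd_ramificationIdx` (`…LowerBSD3OverSolventQuarticHabitat.lean`, seat
tqs-p1-w3 g3). It is the `p = 3`, cell-(t′) twin of the tree's `p ≥ 5` criterion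
`Additive.hasGoodReductionAt_baseChange_iff_semistabilityIndex_dvd` (whose converse needs residue
characteristic `≥ 5`). No Iwasawa-theoretic content; the crux stays OPEN (blocked-on
stmt-BirchSwinnertonDyer-23739) and BSD is not proved by any of this.

WHAT. For `W/ℚ` globally minimal, elliptic, additive at `3` of census class (t′), any number field `L`, any
place `v ∋ 3`:
* `hasGoodReductionAt_baseChange_iff_four_dvd_ramificationIdx` — **`E_L` good at `v` ⟺ `4 ∣ e(v|3)`**;
* `isSemistableAt_baseChange_iff_four_dvd_ramificationIdx` — **`E_L` semistable at `v` ⟺ `4 ∣ e(v|3)`**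
  (semistable = good here: `isSemistableAt_baseChange_iff_hasGoodReductionAt`);
* `not_isSemistableAt_baseChange_of_ramificationIdx_lt_four`, `…_of_not_four_dvd_ramificationIdx` — the
  leaf stays ADDITIVE at every place above `3` with `e(v|3) < 4` or `4 ∤ e(v|3)`: unramified bases, quadratic
  bases (the route's `K = ℚ(√d)`, `e ≤ 2`), cubic and sextic ramification (`ℚ(ζ₉)⁺`, `ℚ(ζ₉)`: `e = 3, 6`), the
  `e ∣ p − 1 = 2` bases of Delbourgo's Hyp. (G) — so the habitat of every conceivable mechanism for K1⁻ is
  exactly `{(L, v) : 4 ∣ e(v|3)}`, on which `e(v|3) ≥ 4 > p − 1` (outside B. D. Kim's `e < p` signed theory)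
  and, for odd `f(v|3)`, `a_v = 0` (`frobeniusTraceAt_baseChange_eq_zero_of_four_dvd_ramificationIdx`).

References: J. H. Silverman, *AEC* VII.1 Prop. 1.3, VII.5.1; J.-P. Serre, J. Tate, Ann. of Math. 88 (1968)
§2 Cor. 2.
-/

-- D-0017: single-problem summit, so `Summit.BirchSwinnertonDyer.BirchSwinnertonDyer.…` repeats a namespace BY DESIGN.
set_option linter.dupNamespace false

noncomputable section

open scoped NumberField

open IsDedekindDomain IsDedekindDomain.HeightOneSpectrum NumberField WeierstrassCurve
  Literature.NumberTheory.EllipticCurves Literature.NumberTheory.EllipticCurves.Rank1Residual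
  Summit.BirchSwinnertonDyer.Rank1Residual.Additive

namespace Summit.BirchSwinnertonDyer.BirchSwinnertonDyer.Theorems.LowerBSD3OverSolventQuartic

variable (W : WeierstrassCurve ℚ) [W.IsElliptic] [W.IsGloballyMinimal]

/-- **THE LOCAL CRITERION at `p = 3` on the (t′) cell.** For `W/ℚ` globally minimal, elliptic, additive at `3`
of census class (t′) (`Addv W 3`, `SubTprime W 3`), every number field `L` and every place `v ∋ 3`:
**`W ⊗ L` has good reduction at `v` iff `4 ∣ e(v|3)`.** (⇒) `four_dvd_ramificationIdx_of_hasGoodReductionAt`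
(a `v`-minimal model has unit discriminant, `ord_v = e(v|3)·ord₃` on `ℚ`, `e_E(3) = 4`); (⇐)
`hasGoodReductionAt_baseChange_of_four_dvd_ramificationIdx` (tame descent of the rational companion model at
`(e, k) = (4m, mk)`). Serre–Tate: inertia acts through a cyclic group of order `4`, killed exactly by the
extensions with `4 ∣ e`. [cite: SerreTate1968, §2 Cor. 2] [cite: SilvermanAEC2009, Prop. VII.1.3 and VII.5.1] -/
theorem hasGoodReductionAt_baseChange_iff_four_dvd_ramificationIdx (hadd : Addv W 3)
    (hsub : Summit.BirchSwinnertonDyer.Rank1Residual.Additive.SubTprime W 3)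
    (L : Type) [Field L] [NumberField L] (v : HeightOneSpectrum (𝓞 L))
    (h3 : ((3 : ℕ) : 𝓞 L) ∈ v.asIdeal) :
    (W.baseChange L).HasGoodReductionAt v ↔ 4 ∣ v.asIdeal.ramificationIdx ℤ :=
  ⟨four_dvd_ramificationIdx_of_hasGoodReductionAt W L v hadd hsub h3,
    hasGoodReductionAt_baseChange_of_four_dvd_ramificationIdx W hadd hsub L v h3⟩

/-- **Semistable version**: `W ⊗ L` is semistable at `v ∋ 3` iff `4 ∣ e(v|3)` (a (t′) curve is never
multiplicative above `3`, `isSemistableAt_baseChange_iff_hasGoodReductionAt`).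
[cite: SerreTate1968, §2 Cor. 2] [cite: SilvermanAEC2009, Prop. VII.5.1] -/
theorem isSemistableAt_baseChange_iff_four_dvd_ramificationIdx (hadd : Addv W 3)
    (hsub : Summit.BirchSwinnertonDyer.Rank1Residual.Additive.SubTprime W 3)
    (L : Type) [Field L] [NumberField L] (v : HeightOneSpectrum (𝓞 L))
    (h3 : ((3 : ℕ) : 𝓞 L) ∈ v.asIdeal) :
    (W.baseChange L).IsSemistableAt v ↔ 4 ∣ v.asIdeal.ramificationIdx ℤ := by
  rw [isSemistableAt_baseChange_iff_hasGoodReductionAt W hsub L v h3,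
    hasGoodReductionAt_baseChange_iff_four_dvd_ramificationIdx W hadd hsub L v h3]

/-- **Additivity persists off the habitat**: if `4 ∤ e(v|3)` then `W ⊗ L` is NOT semistable (i.e. is still
additive) at `v`. [cite: SerreTate1968, §2 Cor. 2] [cite: SilvermanAEC2009, Prop. VII.5.1] -/
theorem not_isSemistableAt_baseChange_of_not_four_dvd_ramificationIdx (hadd : Addv W 3)
    (hsub : Summit.BirchSwinnertonDyer.Rank1Residual.Additive.SubTprime W 3)
    (L : Type) [Field L] [NumberField L] (v : HeightOneSpectrum (𝓞 L))
    (h3 : ((3 : ℕ) : 𝓞 L) ∈ v.asIdeal) (h4 : ¬ 4 ∣ v.asIdeal.ramificationIdx ℤ) :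
    ¬ (W.baseChange L).IsSemistableAt v :=
  fun hss ↦ h4 ((isSemistableAt_baseChange_iff_four_dvd_ramificationIdx W hadd hsub L v h3).mp hss)

/-- **No semistable place with `e(v|3) < 4`** — unramified bases (`e = 1`), quadratic bases such as the
route's real quadratic `K = ℚ(√d)` (`e ≤ 2`; so `E_K` is still additive at the primes above `3`, the setting of
the K2a children), cubic ramification (`e = 3`, e.g. `ℚ(ζ₉)⁺`) and the `e ∣ p − 1 = 2` bases of Delbourgo's
Hyp. (G): at all of them a (t′) curve stays additive. [cite: SerreTate1968, §2 Cor. 2]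
[cite: SilvermanAEC2009, Prop. VII.5.1] -/
theorem not_isSemistableAt_baseChange_of_ramificationIdx_lt_four (hadd : Addv W 3)
    (hsub : Summit.BirchSwinnertonDyer.Rank1Residual.Additive.SubTprime W 3)
    (L : Type) [Field L] [NumberField L] (v : HeightOneSpectrum (𝓞 L))
    (h3 : ((3 : ℕ) : 𝓞 L) ∈ v.asIdeal) (hlt : v.asIdeal.ramificationIdx ℤ < 4) :
    ¬ (W.baseChange L).IsSemistableAt v := by
  refine not_isSemistableAt_baseChange_of_not_four_dvd_ramificationIdx W hadd hsub L v h3 fun h4 ↦ ?_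
  have hne := ramificationIdx_int_ne_zero_of_natCast_mem L v 3 h3
  have hle := Nat.le_of_dvd (Nat.pos_of_ne_zero hne) h4
  omega

/-- **Sextic ramification does not help either**: at a place with `e(v|3) = 6` (e.g. above `3` in `ℚ(ζ₉)` or
`ℚ(ζ₃, 3^{1/3})`) a (t′) curve stays additive (`4 ∤ 6`). [cite: SerreTate1968, §2 Cor. 2] -/
theorem not_isSemistableAt_baseChange_of_ramificationIdx_eq_six (hadd : Addv W 3)
    (hsub : Summit.BirchSwinnertonDyer.Rank1Residual.Additive.SubTprime W 3)
    (L : Type) [Field L] [NumberField L] (v : HeightOneSpectrum (𝓞 L))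
    (h3 : ((3 : ℕ) : 𝓞 L) ∈ v.asIdeal) (h6 : v.asIdeal.ramificationIdx ℤ = 6) :
    ¬ (W.baseChange L).IsSemistableAt v :=
  not_isSemistableAt_baseChange_of_not_four_dvd_ramificationIdx W hadd hsub L v h3 (by rw [h6]; decide)

/-- **The habitat, summarised.** For `W` on the (t′) leaf, a number field `L` and a place `v ∋ 3` with
`4 ∣ e(v|3)` and odd residue degree: `W ⊗ L` is good at `v` with `a_v = 0` (supersingular, trace zero); and at a
place with `4 ∤ e(v|3)` it is additive. [cite: SerreTate1968, §2 Cor. 2] [cite: SilvermanAEC2009, C.§16] -/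
theorem hasGoodReductionAt_and_frobeniusTraceAt_eq_zero_of_four_dvd_ramificationIdx (hadd : Addv W 3)
    (hsub : Summit.BirchSwinnertonDyer.Rank1Residual.Additive.SubTprime W 3)
    (L : Type) [Field L] [NumberField L] (v : HeightOneSpectrum (𝓞 L))
    (h3 : ((3 : ℕ) : 𝓞 L) ∈ v.asIdeal) (h4 : 4 ∣ v.asIdeal.ramificationIdx ℤ)
    (hf : Odd (v.asIdeal.inertiaDeg ℤ)) :
    (W.baseChange L).HasGoodReductionAt v ∧ (W.baseChange L).frobeniusTraceAt v = 0 :=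
  ⟨hasGoodReductionAt_baseChange_of_four_dvd_ramificationIdx W hadd hsub L v h3 h4,
    frobeniusTraceAt_baseChange_eq_zero_of_four_dvd_ramificationIdx W hadd hsub L v h3 h4 hf⟩

end Summit.BirchSwinnertonDyer.BirchSwinnertonDyer.Theorems.LowerBSD3OverSolventQuartic

end
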